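/-
Origin: expansion seat `planner-pub-hodgecm-toy-g3-0`, handover #3 v3 2026-08-18T12:03Z (md5 f2a0ec7f) (`HOME/pub-hodgecm-toy-g3/lean/ToyG3/OpenInputsAll3.lean`, md5 f2a0ec7f, 101 lines);
landed by the gen-8 packager in gate run 29 as `HodgeCM/Model/ToyG2/OpenInputsAll3.lean` (import ^import ToyG3\.OpenInputs3[ \t]*$→import HodgeCM.Model.ToyG2.OpenInputs3 ×1).
-/
/-
Copyright: pub-hodgecm formalisation cell (harness21, 2026). New file (not vendored).
Origin: session planner-pub-hodgecm-toy-g3-0 (unit pub-hodgecm-toy-g3, EXPANSION part (e) CONSISTENCY WITNESS, gen 3 of the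
lineage toy → toy-g2 → toy-g3), 2026-08-18.  WIP module `ToyG3.OpenInputsAll3`; intended final place
`HodgeCM/Model/ToyG2/OpenInputsAll3.lean` (module `HodgeCM.Model.ToyG2.OpenInputsAll3`; kind L5, toy model / consistency
witness — ONE NEW ADDITIVE FILE, no landed file is touched).  ONE WIP import to rewrite on landing:
`import ToyG3.OpenInputs3` ↦ `import HodgeCM.Model.ToyG2.OpenInputs3` (this seat, same handover; LAND ORDER: after it);
`HodgeCM.Model.ToyG2.SplitAllGood` is pv03-g6's (md5 c679c3209afc), in the tree since gate run 28, imported by its FINAL name.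
-/
import Mathlib
import Summits.HodgeConjecture.HodgeCM.Model.ToyG2.OpenInputs3
import Summits.HodgeConjecture.HodgeCM.Model.ToyG2.SplitAllGood

/-!
# The joint G4 witness: `∃ U, U.ModelAxioms ∧ U.OpenInputs`

`HodgeCM.Model.ToyG2.OpenInputs3` proves the four open inputs of `HodgeCM.Universe.OpenInputs` in the generation-2 toy
universe `toyUniverse₃ d t` (`1 ≤ d`, `t² = 16`) under its model axioms, and the joint witness modulo the one
displayed model axiom M26.  pv03-g6's `HodgeCM.Model.ToyG2.SplitAllGood` proves M26 for every good surface
(`toyUniverse₃_modelAxioms_all d t : (toyUniverse₃ d t).ModelAxioms`, closing toy-g2's `SplitInput` programme G1–G3).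
Hence, unconditionally and with nothing posited:

* `toyUniverse₃_openInputs_all (hd) (ht) : (toyUniverse₃ d t).OpenInputs`;
* `exists_modelAxioms_and_openInputs : ∃ U : Universe, U.ModelAxioms ∧ U.OpenInputs` — **the hypothesis set of both
  headline theorems (`Assembly.COR_CM_of_openInputs`, `Assembly.perL_of_openInputs`) is satisfiable** (referee A, G4);
* `openInputs_independent` — together with generation 1 (`HodgeCM.Toy.toyModel_modelAxioms`, `toyModel_not_openInputs'`):
  `OpenInputs` is INDEPENDENT of the 28 model axioms — neither it nor its negation follows from `ModelAxioms`;
* `toyUniverse₃_profile_all` — `ModelAxioms` and the whole headline cone (`OpenInputs`, Pohlmann ×3, `Qw8Sufficiency`,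
  `HC_CM`, `PerL`, `PeriodThmF`, `W_RK4`, `FaceReduction`, `Lemma81`) TRUE in one explicit structure.

As always for this lineage: a statement about the typed interface of the package, not about complex projective varieties —
the realisation inputs remain OPEN for the intended universe.
-/

noncomputable section

namespace HodgeCM.ToyG2

open HodgeCM.Toy

section

variable (d t : ℚ) (hd : (1 : ℚ) ≤ d) (ht : t ^ 2 = 16)
include hd ht

/-- **All four open inputs hold in `toyUniverse₃ d t`**, `1 ≤ d`, `t² = 16` — no hypothesis. -/
theorem toyUniverse₃_openInputs_all : (toyUniverse₃ d t).OpenInputs :=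
  toyUniverse₃_openInputs d t hd ht (toyUniverse₃_modelAxioms_all d t)

/-- `ModelAxioms ∧ OpenInputs` for `toyUniverse₃ d t`. -/
theorem toyUniverse₃_modelAxioms_and_openInputs : (toyUniverse₃ d t).ModelAxioms ∧ (toyUniverse₃ d t).OpenInputs :=
  ⟨toyUniverse₃_modelAxioms_all d t, toyUniverse₃_openInputs_all d t hd ht⟩

/-- The headline theorems run on the model, unconditionally: `HC_CM ∧ PerL ∧ PeriodThmF ∧ W_RK4` in `toyUniverse₃ d t`. -/
theorem toyUniverse₃_headline_all :
    (toyUniverse₃ d t).HC_CM ∧ (toyUniverse₃ d t).PerL ∧ (toyUniverse₃ d t).PeriodThmF ∧ (toyUniverse₃ d t).W_RK4 :=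
  toyUniverse₃_headline d t hd ht (toyUniverse₃_modelAxioms_all d t)

/-- **Truth table of `toyUniverse₃ d t`, unconditionally**: the 28 model axioms and every statement in the cone of the
headline theorems are TRUE. -/
theorem toyUniverse₃_profile_all :
    (toyUniverse₃ d t).ModelAxioms ∧ (toyUniverse₃ d t).OpenInputs ∧
      ((toyUniverse₃ d t).RealisationExistsPerL ∧ (toyUniverse₃ d t).RealisationExistsFace ∧
        (toyUniverse₃ d t).PohlmannSpan ∧ (toyUniverse₃ d t).PohlmannBasis ∧ (toyUniverse₃ d t).PohlmannTheorem31 ∧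
        (toyUniverse₃ d t).Qw8Sufficiency) ∧
      ((toyUniverse₃ d t).HC_CM ∧ (toyUniverse₃ d t).PerL ∧ (toyUniverse₃ d t).PeriodThmF ∧
        (toyUniverse₃ d t).W_RK4 ∧ (toyUniverse₃ d t).FaceReduction ∧ (toyUniverse₃ d t).Lemma81) :=
  ⟨toyUniverse₃_modelAxioms_all d t, toyUniverse₃_profile d t hd ht (toyUniverse₃_modelAxioms_all d t)⟩

end

/-! ### Referee A, G4: the joint witness and the independence of `OpenInputs` -/

/-- **G4, joint form: `∃ U, U.ModelAxioms ∧ U.OpenInputs`** — the hypothesis set of `Assembly.COR_CM_of_openInputs` and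
`Assembly.perL_of_openInputs` is satisfiable, witnessed by `toyUniverse₃ 1 4`. -/
theorem exists_modelAxioms_and_openInputs : ∃ U : Universe, U.ModelAxioms ∧ U.OpenInputs :=
  ⟨toyUniverse₃ 1 4, toyUniverse₃_modelAxioms_and_openInputs 1 4 le_rfl (by norm_num)⟩

/-- The same with the two headline conclusions displayed: `ModelAxioms ∧ OpenInputs ∧ HC_CM ∧ PerL` in one universe. -/
theorem exists_modelAxioms_and_openInputs_and_headline :
    ∃ U : Universe, U.ModelAxioms ∧ U.OpenInputs ∧ U.HC_CM ∧ U.PerL :=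
  have h := toyUniverse₃_headline_all 1 4 le_rfl (by norm_num)
  ⟨toyUniverse₃ 1 4, toyUniverse₃_modelAxioms_all 1 4, toyUniverse₃_openInputs_all 1 4 le_rfl (by norm_num), h.1, h.2.1⟩

/-- **`OpenInputs` is independent of the model axioms**: there is a universe with all 28 model axioms in which
`OpenInputs` HOLDS (`toyUniverse₃ 1 4`, generation 2) and one in which it FAILS (`HodgeCM.Toy.toyModel`, generation 1:
all periods vanish, so both theta realisations are empty). -/
theorem exists_models_separating_openInputs :
    (∃ U : Universe, U.ModelAxioms ∧ U.OpenInputs) ∧ (∃ U : Universe, U.ModelAxioms ∧ ¬ U.OpenInputs) :=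
  ⟨exists_modelAxioms_and_openInputs, ⟨toyModel, toyModel_modelAxioms, toyModel_not_openInputs'⟩⟩

/-- Hence neither `ModelAxioms → OpenInputs` nor `ModelAxioms → ¬ OpenInputs` is a theorem about all universes. -/
theorem openInputs_independent :
    (¬ ∀ U : Universe, U.ModelAxioms → U.OpenInputs) ∧ (¬ ∀ U : Universe, U.ModelAxioms → ¬ U.OpenInputs) :=
  ⟨fun h => toyModel_not_openInputs' (h toyModel toyModel_modelAxioms),
    fun h => h (toyUniverse₃ 1 4) (toyUniverse₃_modelAxioms_all 1 4)
      (toyUniverse₃_openInputs_all 1 4 le_rfl (by norm_num))⟩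

end HodgeCM.ToyG2

end
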